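import Literature.MathematicalPhysics.KineticTheory.StaticHazardStatics
import Literature.Analysis.FluidPDE.HardSphereDynamicsProofs
import HarnessLib

/-!
# The dilute static hazard is dominated by the kinetic energy

Topic `Literature/MathematicalPhysics/KineticTheory` — companion of `CollisionWindowCompensator.lean` (the static hazard
`staticHazard`, the toroidal dilute cut `toroidalDiluteCut`, the window sum `windowSum`) and `StaticHazardStatics.lean`.
Enskog's collision frequency of sphere `i` read on a coarse state, `ν̂ᵢ = π Y(σ³ n_{cellᵢ}) Σ_{j ≠ i in cellᵢ} ‖vᵢ − vⱼ‖ /((N+1) r'³)`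
(Chapman–Cowling 1970 §16.2), restricted to DILUTE cells (`σ³ n ≤ η̄`, where the contact value is bounded by `K_Y`), is
controlled by the speeds alone: `‖vᵢ − vⱼ‖ ≤ ‖vᵢ‖ + ‖vⱼ‖` and a dilute cell holds at most `(η̄/σ³)(N+1) r'³` spheres, so

* `sum_abs_toroidalDiluteCut_mul_staticHazard_le` — `Σᵢ |dilᵢ| |ν̂ᵢ| ≤ 2π K_Y (η̄/σ³) Σ_l ‖v_l‖` for every coarse state;
* `mul_abs_windowSum_toroidalDiluteCut_staticHazard_le` — along a hard-sphere flow, for coarse weights `|h| ≤ C`, the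
  static side of the window bookkeeping obeys
  `(σ³w/ε) |WS(h·dil, ν̂)| ≤ C · 2π K_Y η̄ · w Σ_{k<Kw} (N+1)⁻¹ Σ_l ‖v_l(kw)‖` (pointwise in the initial datum);
* `inv_mul_sum_norm_vel_le_sqrt` — `(N+1)⁻¹ Σ_l ‖v_l‖ ≤ √(2E(z)/(N+1))` (Cauchy–Schwarz);
* `mul_abs_windowSum_toroidalDiluteCut_staticHazard_le_of_mem_good` — on the good set of the flow (energy is conserved
  along the orbit) `(σ³w/ε) |WS(h·dil, ν̂)|(z) ≤ C · 2π K_Y η̄ · τ · √(2E(z)/(N+1))`, so that the static side of the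
  static-hazard-law / mesoscale-regularity functionals of the crux line `Sketch` of `InformationPercolationEngine.CollisionRate`
  (stmt-AtomisticToContinuum-13481) is tight under ANY law with tight kinetic energy per particle (no hot-spot blow-up).

## References

* S. Chapman, T. G. Cowling, *The Mathematical Theory of Non-Uniform Gases*, 3rd ed. (1970), §16.2–16.4.
  [ChapmanCowling1970]
* I. Gallagher, L. Saint-Raymond, B. Texier, *From Newton to Boltzmann* (2013), §1.1 (conservation of energy).  [GST2013]

## Not here

No measure and no dynamics beyond energy conservation: the window hazard `κ = E_G[D | coarse state]` (the other side of the
static hazard law) is problem-side.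
-/

noncomputable section

open scoped BigOperators
open Set MeasureTheory Finset
open Literature.Analysis.FluidPDE

namespace Literature.MathematicalPhysics.KineticTheory

variable {σ : ℝ} {N : ℕ} {r' ηb : ℝ}

/-! ## One sphere: the static hazard against the speeds of its cell -/

/-- **The static hazard of one sphere against the speeds of its cell**: `|ν̂ᵢ| ≤ π |Y(σ³ n_{cellᵢ})| (#cellᵢ ‖vᵢ‖ +
Σ_{j ∈ cellᵢ} ‖vⱼ‖)/((N+1) r'³)` (`0 < r'`; `‖vᵢ − vⱼ‖ ≤ ‖vᵢ‖ + ‖vⱼ‖`, the partners `j ≠ i` of the cell are among its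
occupants). [cite: ChapmanCowling1970, §16.2] -/
theorem abs_staticHazard_le (hr' : 0 < r') (p : CoarseState N) (i : Fin (N + 1)) :
    |staticHazard σ N r' p i| ≤ Real.pi * |contactValue (σ ^ 3 * cellDensity N r' (cellsOf p) (cellsOf p i))| *
      ((((Finset.univ.filter fun j : Fin (N + 1) => cellsOf p j = cellsOf p i).card : ℝ) * ‖(p i).2‖ +
        ∑ j ∈ Finset.univ.filter (fun j : Fin (N + 1) => cellsOf p j = cellsOf p i), ‖(p j).2‖) /
        ((((N + 1 : ℕ) : ℝ)) * r' ^ 3)) := by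
  classical
  have hM : (0 : ℝ) < (((N + 1 : ℕ) : ℝ)) * r' ^ 3 := by positivity
  have hST : (Finset.univ.filter fun j : Fin (N + 1) => j ≠ i ∧ cellsOf p j = cellsOf p i) ⊆
      Finset.univ.filter fun j : Fin (N + 1) => cellsOf p j = cellsOf p i := by
    intro j hj
    simp only [Finset.mem_filter, Finset.mem_univ, true_and] at hj ⊢
    exact hj.2
  have hsum : ∑ j ∈ Finset.univ.filter (fun j : Fin (N + 1) => j ≠ i ∧ cellsOf p j = cellsOf p i), ‖(p i).2 - (p j).2‖ ≤
      ((Finset.univ.filter fun j : Fin (N + 1) => cellsOf p j = cellsOf p i).card : ℝ) * ‖(p i).2‖ +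
        ∑ j ∈ Finset.univ.filter (fun j : Fin (N + 1) => cellsOf p j = cellsOf p i), ‖(p j).2‖ := by
    calc ∑ j ∈ Finset.univ.filter (fun j : Fin (N + 1) => j ≠ i ∧ cellsOf p j = cellsOf p i), ‖(p i).2 - (p j).2‖
        ≤ ∑ j ∈ Finset.univ.filter (fun j : Fin (N + 1) => cellsOf p j = cellsOf p i), ‖(p i).2 - (p j).2‖ :=
          Finset.sum_le_sum_of_subset_of_nonneg hST fun j _ _ => norm_nonneg _
      _ ≤ ∑ j ∈ Finset.univ.filter (fun j : Fin (N + 1) => cellsOf p j = cellsOf p i), (‖(p i).2‖ + ‖(p j).2‖) :=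
          Finset.sum_le_sum fun j _ => norm_sub_le _ _
      _ = ((Finset.univ.filter fun j : Fin (N + 1) => cellsOf p j = cellsOf p i).card : ℝ) * ‖(p i).2‖ +
            ∑ j ∈ Finset.univ.filter (fun j : Fin (N + 1) => cellsOf p j = cellsOf p i), ‖(p j).2‖ := by
          rw [Finset.sum_add_distrib, Finset.sum_const, nsmul_eq_mul]
  have h0 : 0 ≤ ∑ j ∈ Finset.univ.filter (fun j : Fin (N + 1) => j ≠ i ∧ cellsOf p j = cellsOf p i),
      ‖(p i).2 - (p j).2‖ := Finset.sum_nonneg fun j _ => norm_nonneg _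
  unfold staticHazard
  rw [abs_mul, abs_mul, abs_of_pos Real.pi_pos, abs_div, abs_of_pos hM, abs_of_nonneg h0]
  exact mul_le_mul_of_nonneg_left (div_le_div_of_nonneg_right hsum hM.le) (by positivity)

/-! ## All spheres: the dilute static hazard against the total speed -/

/-- **On a dilute cell the occupancy is at most `(η̄/σ³)(N+1) r'³`**: if some sphere `i₀` of the cell of `j` has
`dil_{i₀} = 1` then `#{i : cellᵢ = cellⱼ} ≤ (η̄/σ³) (N+1) r'³` (`0 < σ`, `0 < r'`). [folklore] -/
theorem card_filter_cellsOf_eq_le_of_toroidalDiluteCutCells_eq_one (hσ : 0 < σ) (hr' : 0 < r')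
    {c : Fin (N + 1) → (Fin 3 → ℤ)} {i₀ j : Fin (N + 1)} (hij : c j = c i₀)
    (h1 : toroidalDiluteCutCells σ N r' ηb i₀ c = 1) :
    ((Finset.univ.filter fun i : Fin (N + 1) => c i = c j).card : ℝ) ≤ ηb / σ ^ 3 * ((((N + 1 : ℕ) : ℝ)) * r' ^ 3) := by
  have hs : 0 < σ ^ 3 := pow_pos hσ 3
  have hM : (0 : ℝ) ≤ (((N + 1 : ℕ) : ℝ)) * r' ^ 3 := by positivity
  have hn : σ ^ 3 * cellDensity N r' c (c i₀) ≤ ηb := cellDensity_le_of_toroidalDiluteCutCells_eq_one hr' h1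
  rw [card_filter_eq_mul_cellDensity N hr'.ne' c (c j), hij, div_mul_eq_mul_div, le_div_iff₀ hs]
  nlinarith [mul_le_mul_of_nonneg_left hn hM]

/-- **The dilute static hazard is dominated by the total speed**: for every coarse state
`Σᵢ |dilᵢ| · |ν̂ᵢ| ≤ 2π K_Y (η̄/σ³) Σ_l ‖v_l‖`, where `|Y| ≤ K_Y` on `[0, η̄]`, `0 ≤ η̄`, `0 < σ`, `0 < r'`
(own-speed part: `#cellᵢ ≤ (η̄/σ³)(N+1)r'³` on `{dilᵢ = 1}`; partner part: after exchanging the sums, sphere `l` is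
counted by the dilute spheres of its own cell, at most `(η̄/σ³)(N+1)r'³` of them). [cite: ChapmanCowling1970, §16.2] -/
theorem sum_abs_toroidalDiluteCut_mul_staticHazard_le (hσ : 0 < σ) (hr' : 0 < r') (hηb : 0 ≤ ηb) {KY : ℝ}
    (hKY : ∀ y, 0 ≤ y → y ≤ ηb → |contactValue y| ≤ KY) (p : CoarseState N) :
    ∑ i, |toroidalDiluteCut σ N r' ηb i p| * |staticHazard σ N r' p i| ≤
      2 * Real.pi * KY * (ηb / σ ^ 3) * ∑ l, ‖(p l).2‖ := by
  classical
  have hKY0 : 0 ≤ KY := (abs_nonneg _).trans (hKY 0 le_rfl hηb)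
  have hs : 0 < σ ^ 3 := pow_pos hσ 3
  set c : Fin (N + 1) → (Fin 3 → ℤ) := cellsOf p with hc
  set M : ℝ := (((N + 1 : ℕ) : ℝ)) * r' ^ 3 with hM
  have hM0 : 0 < M := by positivity
  -- the dilute cut of sphere `i` as a number in `{0, 1}`
  have hdil : ∀ i, toroidalDiluteCut σ N r' ηb i p = toroidalDiluteCutCells σ N r' ηb i c := fun i => rfl
  -- Step A: one sphere
  have hA : ∀ i, |toroidalDiluteCut σ N r' ηb i p| * |staticHazard σ N r' p i| ≤
      Real.pi * KY * (ηb / σ ^ 3) * ‖(p i).2‖ +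
        Real.pi * KY / M * (|toroidalDiluteCut σ N r' ηb i p| * ∑ j, if c j = c i then ‖(p j).2‖ else 0) := by
    intro i
    rcases toroidalDiluteCutCells_eq_zero_or_one (σ := σ) (r' := r') (ηb := ηb) i c with h0 | h1
    · rw [hdil i, h0, abs_zero, zero_mul, zero_mul, mul_zero, add_zero]
      positivity
    · have hn : σ ^ 3 * cellDensity N r' c (c i) ≤ ηb := cellDensity_le_of_toroidalDiluteCutCells_eq_one hr' h1
      have hn0 : 0 ≤ σ ^ 3 * cellDensity N r' c (c i) := (mul_nonneg hs.le (cellDensity_nonneg N hr'.le c (c i)))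
      have hY : |contactValue (σ ^ 3 * cellDensity N r' c (c i))| ≤ KY := hKY _ hn0 hn
      have hcard : ((Finset.univ.filter fun j : Fin (N + 1) => c j = c i).card : ℝ) ≤ ηb / σ ^ 3 * M :=
        card_filter_cellsOf_eq_le_of_toroidalDiluteCutCells_eq_one hσ hr' rfl h1
      have hfilter : ∑ j ∈ Finset.univ.filter (fun j : Fin (N + 1) => c j = c i), ‖(p j).2‖ =
          ∑ j, if c j = c i then ‖(p j).2‖ else 0 := by
        rw [Finset.sum_filter]
      have hS0 : 0 ≤ ∑ j, if c j = c i then ‖(p j).2‖ else 0 :=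
        Finset.sum_nonneg fun j _ => by split_ifs <;> positivity
      rw [hdil i, h1, abs_one, one_mul, one_mul]
      calc |staticHazard σ N r' p i|
          ≤ Real.pi * |contactValue (σ ^ 3 * cellDensity N r' c (c i))| *
              ((((Finset.univ.filter fun j : Fin (N + 1) => c j = c i).card : ℝ) * ‖(p i).2‖ +
                ∑ j ∈ Finset.univ.filter (fun j : Fin (N + 1) => c j = c i), ‖(p j).2‖) / M) :=
            abs_staticHazard_le hr' p i
        _ ≤ Real.pi * KY * ((ηb / σ ^ 3 * M * ‖(p i).2‖ + ∑ j, if c j = c i then ‖(p j).2‖ else 0) / M) := by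
            rw [hfilter]
            refine mul_le_mul (mul_le_mul_of_nonneg_left hY Real.pi_pos.le)
              (div_le_div_of_nonneg_right (add_le_add (mul_le_mul_of_nonneg_right hcard (norm_nonneg _)) le_rfl)
                hM0.le) (by positivity) (by positivity)
        _ = Real.pi * KY * (ηb / σ ^ 3) * ‖(p i).2‖ +
              Real.pi * KY / M * ∑ j, if c j = c i then ‖(p j).2‖ else 0 := by
            field_simp
  -- Step B: the partner part, summed over `i`, after exchanging the sums
  have hD : ∀ j, ∑ i, (if c j = c i then |toroidalDiluteCut σ N r' ηb i p| else 0) ≤ ηb / σ ^ 3 * M := by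
    intro j
    by_cases hex : ∃ i₀, c j = c i₀ ∧ toroidalDiluteCutCells σ N r' ηb i₀ c = 1
    · obtain ⟨i₀, hij, h1⟩ := hex
      calc ∑ i, (if c j = c i then |toroidalDiluteCut σ N r' ηb i p| else 0)
          ≤ ∑ i, (if c i = c j then (1 : ℝ) else 0) := by
            refine Finset.sum_le_sum fun i _ => ?_
            by_cases h : c j = c i
            · rw [if_pos h, if_pos h.symm]; exact abs_toroidalDiluteCut_le_one σ N r' ηb i p
            · rw [if_neg h, if_neg (fun h' => h h'.symm)]
        _ = ((Finset.univ.filter fun i : Fin (N + 1) => c i = c j).card : ℝ) := by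
            rw [Finset.sum_boole]
        _ ≤ ηb / σ ^ 3 * M := card_filter_cellsOf_eq_le_of_toroidalDiluteCutCells_eq_one hσ hr' hij h1
    · have hzero : ∀ i, (if c j = c i then |toroidalDiluteCut σ N r' ηb i p| else 0) = 0 := by
        intro i
        split_ifs with h
        · rcases toroidalDiluteCutCells_eq_zero_or_one (σ := σ) (r' := r') (ηb := ηb) i c with h0 | h1
          · rw [hdil i, h0, abs_zero]
          · exact absurd ⟨i, h, h1⟩ hex
        · rfl
      simp only [hzero, Finset.sum_const_zero]
      positivity
  have hB : ∑ i, |toroidalDiluteCut σ N r' ηb i p| * (∑ j, if c j = c i then ‖(p j).2‖ else 0) ≤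
      ηb / σ ^ 3 * M * ∑ l, ‖(p l).2‖ := by
    calc ∑ i, |toroidalDiluteCut σ N r' ηb i p| * (∑ j, if c j = c i then ‖(p j).2‖ else 0)
        = ∑ i, ∑ j, ‖(p j).2‖ * (if c j = c i then |toroidalDiluteCut σ N r' ηb i p| else 0) := by
          refine Finset.sum_congr rfl fun i _ => ?_
          rw [Finset.mul_sum]
          refine Finset.sum_congr rfl fun j _ => ?_
          split_ifs <;> ring
      _ = ∑ j, ‖(p j).2‖ * ∑ i, (if c j = c i then |toroidalDiluteCut σ N r' ηb i p| else 0) := by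
          rw [Finset.sum_comm]
          exact Finset.sum_congr rfl fun j _ => by rw [Finset.mul_sum]
      _ ≤ ∑ j, ‖(p j).2‖ * (ηb / σ ^ 3 * M) :=
          Finset.sum_le_sum fun j _ => mul_le_mul_of_nonneg_left (hD j) (norm_nonneg _)
      _ = ηb / σ ^ 3 * M * ∑ l, ‖(p l).2‖ := by rw [← Finset.sum_mul, mul_comm]
  -- Step C: assemble
  calc ∑ i, |toroidalDiluteCut σ N r' ηb i p| * |staticHazard σ N r' p i|
      ≤ ∑ i, (Real.pi * KY * (ηb / σ ^ 3) * ‖(p i).2‖ +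
          Real.pi * KY / M * (|toroidalDiluteCut σ N r' ηb i p| * ∑ j, if c j = c i then ‖(p j).2‖ else 0)) :=
        Finset.sum_le_sum fun i _ => hA i
    _ = Real.pi * KY * (ηb / σ ^ 3) * ∑ i, ‖(p i).2‖ +
          Real.pi * KY / M * ∑ i, |toroidalDiluteCut σ N r' ηb i p| * (∑ j, if c j = c i then ‖(p j).2‖ else 0) := by
        rw [Finset.sum_add_distrib, ← Finset.mul_sum, ← Finset.mul_sum]
    _ ≤ Real.pi * KY * (ηb / σ ^ 3) * ∑ i, ‖(p i).2‖ + Real.pi * KY / M * (ηb / σ ^ 3 * M * ∑ l, ‖(p l).2‖) :=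
        add_le_add le_rfl (mul_le_mul_of_nonneg_left hB (by positivity))
    _ = 2 * Real.pi * KY * (ηb / σ ^ 3) * ∑ l, ‖(p l).2‖ := by
        field_simp
        ring

/-! ## Along a flow: the static side of the window bookkeeping against the kinetic energy -/

/-- **The static side of the window sum against the speeds at the window starts**: for coarse weights `|h| ≤ C`,
`(σ³w/ε) |WS(h·dil, ν̂)(z)| ≤ C · 2π K_Y η̄ · w · Σ_{k<Kw} (N+1)⁻¹ Σ_l ‖v_l(Φ_{kw} z)‖` (`0 < σ`, `0 < r'`, `0 ≤ η̄`,
`|Y| ≤ K_Y` on `[0, η̄]`, `0 < τ`, `0 < a`; the coarse state at a window start carries the exact velocities).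
[cite: ChapmanCowling1970, §16.4] -/
theorem mul_abs_windowSum_toroidalDiluteCut_staticHazard_le (hσ : 0 < σ) (hr' : 0 < r') (hηb : 0 ≤ ηb) {KY : ℝ}
    (hKY : ∀ y, 0 ≤ y → y ≤ ηb → |contactValue y| ≤ KY)
    (Φ : HardSphereFlow (Torus.geometry (Fin 3)) (hsDiameter σ N) (N + 1)) {τ a : ℝ} (hτ : 0 < τ) (ha : 0 < a)
    {h : Fin (N + 1) → ℕ → CoarseState N → ℝ} {C : ℝ} (hC : ∀ i k q, |h i k q| ≤ C)
    (z : Config (N + 1) (Fin 3) T3) :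
    σ ^ 3 * windowLen N τ a / hsDiameter σ N *
        |windowSum σ N Φ r' τ a (fun i k q => h i k q * toroidalDiluteCut σ N r' ηb i q)
          (fun i k z => staticHazard σ N r' (coarseStateAt σ N Φ r' τ a k z) i) z| ≤
      C * (2 * Real.pi * KY * ηb) * windowLen N τ a *
        ∑ k ∈ Finset.range (windowNum N τ a),
          ((N : ℝ) + 1)⁻¹ * ∑ l, ‖(Φ.flow ((k : ℝ) * windowLen N τ a) z l).2‖ := by
  have hε : 0 < hsDiameter σ N := hsDiameter_pos hσ N
  have hw : 0 < windowLen N τ a := windowLen_pos N hτ ha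
  have hC0 : 0 ≤ C := (abs_nonneg _).trans (hC 0 0 fun _ => (0, 0))
  have hKY0 : 0 ≤ KY := (abs_nonneg _).trans (hKY 0 le_rfl hηb)
  have hN : (0 : ℝ) < (N : ℝ) + 1 := by positivity
  set p : ℕ → CoarseState N := fun k => coarseStateAt σ N Φ r' τ a k z with hp
  have hvel : ∀ k l, ((p k) l).2 = (Φ.flow ((k : ℝ) * windowLen N τ a) z l).2 := fun k l => rfl
  -- one window
  have hwin : ∀ k, ∑ i, |h i k (p k) * toroidalDiluteCut σ N r' ηb i (p k)| * |staticHazard σ N r' (p k) i| ≤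
      C * (2 * Real.pi * KY * (ηb / σ ^ 3) * ∑ l, ‖(Φ.flow ((k : ℝ) * windowLen N τ a) z l).2‖) := by
    intro k
    calc ∑ i, |h i k (p k) * toroidalDiluteCut σ N r' ηb i (p k)| * |staticHazard σ N r' (p k) i|
        ≤ ∑ i, C * (|toroidalDiluteCut σ N r' ηb i (p k)| * |staticHazard σ N r' (p k) i|) := by
          refine Finset.sum_le_sum fun i _ => ?_
          rw [abs_mul, mul_assoc]
          exact mul_le_mul_of_nonneg_right (hC i k _) (by positivity)
      _ = C * ∑ i, |toroidalDiluteCut σ N r' ηb i (p k)| * |staticHazard σ N r' (p k) i| := by rw [Finset.mul_sum]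
      _ ≤ C * (2 * Real.pi * KY * (ηb / σ ^ 3) * ∑ l, ‖((p k) l).2‖) :=
          mul_le_mul_of_nonneg_left (sum_abs_toroidalDiluteCut_mul_staticHazard_le hσ hr' hηb hKY (p k)) hC0
      _ = C * (2 * Real.pi * KY * (ηb / σ ^ 3) * ∑ l, ‖(Φ.flow ((k : ℝ) * windowLen N τ a) z l).2‖) := by
          simp only [hvel]
  -- all windows
  have hsum : |∑ i : Fin (N + 1), ∑ k ∈ Finset.range (windowNum N τ a),
      h i k (p k) * toroidalDiluteCut σ N r' ηb i (p k) * staticHazard σ N r' (p k) i| ≤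
      ∑ k ∈ Finset.range (windowNum N τ a),
        C * (2 * Real.pi * KY * (ηb / σ ^ 3) * ∑ l, ‖(Φ.flow ((k : ℝ) * windowLen N τ a) z l).2‖) := by
    rw [Finset.sum_comm]
    refine (Finset.abs_sum_le_sum_abs _ _).trans (Finset.sum_le_sum fun k _ => ?_)
    refine (Finset.abs_sum_le_sum_abs _ _).trans ?_
    refine le_trans (Finset.sum_le_sum fun i _ => ?_) (hwin k)
    rw [abs_mul]
  have hWS : |windowSum σ N Φ r' τ a (fun i k q => h i k q * toroidalDiluteCut σ N r' ηb i q)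
      (fun i k z => staticHazard σ N r' (coarseStateAt σ N Φ r' τ a k z) i) z| ≤
      hsDiameter σ N / ((N : ℝ) + 1) * ∑ k ∈ Finset.range (windowNum N τ a),
        C * (2 * Real.pi * KY * (ηb / σ ^ 3) * ∑ l, ‖(Φ.flow ((k : ℝ) * windowLen N τ a) z l).2‖) := by
    unfold windowSum
    rw [abs_mul, abs_of_pos (by positivity : (0 : ℝ) < hsDiameter σ N / ((N : ℝ) + 1))]
    exact mul_le_mul_of_nonneg_left hsum (by positivity)
  calc σ ^ 3 * windowLen N τ a / hsDiameter σ N *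
        |windowSum σ N Φ r' τ a (fun i k q => h i k q * toroidalDiluteCut σ N r' ηb i q)
          (fun i k z => staticHazard σ N r' (coarseStateAt σ N Φ r' τ a k z) i) z|
      ≤ σ ^ 3 * windowLen N τ a / hsDiameter σ N * (hsDiameter σ N / ((N : ℝ) + 1) *
          ∑ k ∈ Finset.range (windowNum N τ a),
            C * (2 * Real.pi * KY * (ηb / σ ^ 3) * ∑ l, ‖(Φ.flow ((k : ℝ) * windowLen N τ a) z l).2‖)) :=
        mul_le_mul_of_nonneg_left hWS (by positivity)
    _ = C * (2 * Real.pi * KY * ηb) * windowLen N τ a *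
          ∑ k ∈ Finset.range (windowNum N τ a),
            ((N : ℝ) + 1)⁻¹ * ∑ l, ‖(Φ.flow ((k : ℝ) * windowLen N τ a) z l).2‖ := by
        rw [Finset.mul_sum, Finset.mul_sum, Finset.mul_sum]
        refine Finset.sum_congr rfl fun k _ => ?_
        field_simp

/-- **Mean speed against kinetic energy per particle** (Cauchy–Schwarz): `(N+1)⁻¹ Σ_l ‖v_l‖ ≤ √(2 E(z)/(N+1))`,
`E(z) = ½ Σ_l ‖v_l‖²` (`configEnergy`). [folklore] -/
theorem inv_mul_sum_norm_vel_le_sqrt (z : Config (N + 1) (Fin 3) T3) :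
    ((N : ℝ) + 1)⁻¹ * ∑ l, ‖(z l).2‖ ≤ Real.sqrt (2 * configEnergy z / ((N : ℝ) + 1)) := by
  have hN : (0 : ℝ) < (N : ℝ) + 1 := by positivity
  have hS0 : 0 ≤ ∑ l, ‖(z l).2‖ := Finset.sum_nonneg fun l _ => norm_nonneg _
  have hCS : (∑ l, ‖(z l).2‖) ^ 2 ≤ ((N : ℝ) + 1) * ∑ l, ‖(z l).2‖ ^ 2 := by
    have h := sq_sum_le_card_mul_sum_sq (s := (Finset.univ : Finset (Fin (N + 1)))) (f := fun l => ‖(z l).2‖)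
    simpa using h
  have hE : 2 * configEnergy z = ∑ l, ‖(z l).2‖ ^ 2 := by
    unfold configEnergy; ring
  refine Real.le_sqrt_of_sq_le ?_
  rw [hE, mul_pow, inv_pow, le_div_iff₀ hN]
  calc (((N : ℝ) + 1) ^ 2)⁻¹ * (∑ l, ‖(z l).2‖) ^ 2 * ((N : ℝ) + 1)
      = ((N : ℝ) + 1)⁻¹ * (∑ l, ‖(z l).2‖) ^ 2 := by field_simp
    _ ≤ ((N : ℝ) + 1)⁻¹ * (((N : ℝ) + 1) * ∑ l, ‖(z l).2‖ ^ 2) := mul_le_mul_of_nonneg_left hCS (by positivity)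
    _ = ∑ l, ‖(z l).2‖ ^ 2 := by field_simp

/-- **The static side of the window sum against the kinetic energy of the datum**: on the good set of the flow (where the
kinetic energy is conserved along the orbit, GST 2013 §1.1) and for coarse weights `|h| ≤ C`,
`(σ³w/ε) |WS(h·dil, ν̂)(z)| ≤ C · 2π K_Y η̄ · τ · √(2 E(z)/(N+1))` (`0 < σ`, `0 < r'`, `0 ≤ η̄`, `|Y| ≤ K_Y` on `[0, η̄]`,
`0 < τ`, `0 < a`; the `Kw` windows of length `w` tile `[0, τ)`).  Hence the static side of the static hazard law is tight
under any law whose kinetic energy per particle is tight. [cite: GST2013, §1.1] -/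
theorem mul_abs_windowSum_toroidalDiluteCut_staticHazard_le_of_mem_good (hσ : 0 < σ) (hr' : 0 < r') (hηb : 0 ≤ ηb)
    {KY : ℝ} (hKY : ∀ y, 0 ≤ y → y ≤ ηb → |contactValue y| ≤ KY)
    (Φ : HardSphereFlow (Torus.geometry (Fin 3)) (hsDiameter σ N) (N + 1)) {τ a : ℝ} (hτ : 0 < τ) (ha : 0 < a)
    {h : Fin (N + 1) → ℕ → CoarseState N → ℝ} {C : ℝ} (hC : ∀ i k q, |h i k q| ≤ C)
    {z : Config (N + 1) (Fin 3) T3} (hz : z ∈ Φ.good) :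
    σ ^ 3 * windowLen N τ a / hsDiameter σ N *
        |windowSum σ N Φ r' τ a (fun i k q => h i k q * toroidalDiluteCut σ N r' ηb i q)
          (fun i k z => staticHazard σ N r' (coarseStateAt σ N Φ r' τ a k z) i) z| ≤
      C * (2 * Real.pi * KY * ηb) * τ * Real.sqrt (2 * configEnergy z / ((N : ℝ) + 1)) := by
  have hC0 : 0 ≤ C := (abs_nonneg _).trans (hC 0 0 fun _ => (0, 0))
  have hKY0 : 0 ≤ KY := (abs_nonneg _).trans (hKY 0 le_rfl hηb)
  have hw : 0 < windowLen N τ a := windowLen_pos N hτ ha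
  -- energy conservation along the good orbit
  have hEk : ∀ k : ℕ, configEnergy (Φ.flow ((k : ℝ) * windowLen N τ a) z) = configEnergy z := by
    intro k
    have h1 := IsHardSphereTrajectory.configEnergy_eq_holds (Φ.isTrajectory z hz) ((k : ℝ) * windowLen N τ a) 0
    simpa [Φ.flow_zero z hz] using h1
  have hk : ∀ k : ℕ, ((N : ℝ) + 1)⁻¹ * ∑ l, ‖(Φ.flow ((k : ℝ) * windowLen N τ a) z l).2‖ ≤
      Real.sqrt (2 * configEnergy z / ((N : ℝ) + 1)) := by
    intro k
    have h1 := inv_mul_sum_norm_vel_le_sqrt (Φ.flow ((k : ℝ) * windowLen N τ a) z)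
    rwa [hEk k] at h1
  refine (mul_abs_windowSum_toroidalDiluteCut_staticHazard_le hσ hr' hηb hKY Φ hτ ha hC z).trans ?_
  calc C * (2 * Real.pi * KY * ηb) * windowLen N τ a *
        ∑ k ∈ Finset.range (windowNum N τ a), ((N : ℝ) + 1)⁻¹ * ∑ l, ‖(Φ.flow ((k : ℝ) * windowLen N τ a) z l).2‖
      ≤ C * (2 * Real.pi * KY * ηb) * windowLen N τ a *
          ∑ _k ∈ Finset.range (windowNum N τ a), Real.sqrt (2 * configEnergy z / ((N : ℝ) + 1)) :=
        mul_le_mul_of_nonneg_left (Finset.sum_le_sum fun k _ => hk k) (by positivity)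
    _ = C * (2 * Real.pi * KY * ηb) * (((windowNum N τ a : ℕ) : ℝ) * windowLen N τ a) *
          Real.sqrt (2 * configEnergy z / ((N : ℝ) + 1)) := by
        rw [Finset.sum_const, Finset.card_range, nsmul_eq_mul]
        ring
    _ = C * (2 * Real.pi * KY * ηb) * τ * Real.sqrt (2 * configEnergy z / ((N : ℝ) + 1)) := by
        rw [windowNum_mul_windowLen N hτ ha]

end Literature.MathematicalPhysics.KineticTheory

end
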